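import Mathlib
import Literature.NumberTheory.DiophantineGeometry.PowerTraceStabilizer
import Literature.NumberTheory.DiophantineGeometry.GLHighestWeight
import Literature.Computability.AlgebraicComplexity.LinSubst

/-!
# K2 `PowGenDegreeQP` (stmt-ValiantsHypothesis-11655), line `trace-side-regimes`, row `m = 2`:
# `tr X_n²` is `GL_{n²}`-equivalent to a diagonal quadric, whose sign changes are upper triangular
# stabilisers

Helper file (`--supports stmt-ValiantsHypothesis-11655`).  Input (i) of the three inputs left open by
`…PowGenDegreeQPRowTwoReduction.rowTwo_bound_of_sign_of_fund` for the row `m = 2` of K2, and the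
`hsign` hypothesis given (i):

* `powFormLex_two_eq` — `tr X_n² = ∑_u X_u X_{τu}`, `τ` the transposition of letters
  `(i,j) ↦ (j,i)` of `MatIdx n`;
* `exists_gl_powFormLex_two_eq_diagonal` — an explicit `h₀ ∈ GL_{n²}(k)` (pair substitution
  `X_u ↦ X_u + X_{τu}`, `X_{τu} ↦ X_u - X_{τu}` for `u < τu`; characteristic `≠ 2`) with
  `h₀ · tr X_n² = ∑_u c_u X_u²`, `c_u ∈ {1, 2, -2}` (all nonzero): `Δ_2(tr X_n²)` is the orbit closure
  of a full-rank DIAGONAL quadric;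
* `exists_upperTriangular_sign_fix_diagonal` — for every letter `u` the diagonal sign matrix
  `diag(1,…,-1,…,1)` (`-1` at `u`) is upper triangular, fixes every diagonal quadric, and has the
  prescribed diagonal: this is hypothesis `hsign` of `rowTwo_bound_of_sign_of_fund` at the point
  `h₀ · tr X_n²` (`hsign_powFormLex_two`).

What remains for the row `m = 2` after this file: the Borel (Cholesky) density of a full-rank
diagonal quadric in `Sym²` (`hdense`) and the principal-minor highest-weight vectors (`hfund`).
Honest label: elementary change of variables; stubs OPEN.
-/

namespace Summit.ValiantsHypothesis.ValiantsHypothesis.Theorems.GeneratorObstructions.PowGenDegreeQP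

open MvPolynomial
open Literature.NumberTheory.DiophantineGeometry Literature.Computability.AlgebraicComplexity

-- `Summit.ValiantsHypothesis.ValiantsHypothesis.…` is the tree's mandated single-conjunct layout.
set_option linter.dupNamespace false

noncomputable section

/-! ## 1. `tr X²` as a sum over letters -/

/-- The transposition of letters is an involution. [folklore] -/
theorem transposeLetter_invol {n : ℕ} (u : MatIdx n) :
    toLex ((ofLex (toLex ((ofLex u).2, (ofLex u).1) : MatIdx n)).2,
      (ofLex (toLex ((ofLex u).2, (ofLex u).1) : MatIdx n)).1) = u := by
  simp

/-- `tr X_n² = ∑_u X_u · X_{τu}` over the letters `u = (i,j)` of `MatIdx n`, `τ(i,j) = (j,i)`.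
[cite: GesmundoIkenmeyerPanova2017, §2.2 (definition of Pow)] -/
theorem powFormLex_two_eq (k : Type*) [Field k] (n : ℕ) :
    powFormLex k n 2 =
      ∑ u : MatIdx n, X u * X (toLex ((ofLex u).2, (ofLex u).1) : MatIdx n) := by
  have h1 : powFormLex k n 2 =
      ∑ i : Fin n, ∑ j : Fin n, (X (toLex (i, j)) * X (toLex (j, i)) : MvPolynomial (MatIdx n) k) := by
    rw [powFormLex, powTrace, sq, Matrix.trace]
    simp only [Matrix.diag_apply, Matrix.mul_apply, Matrix.mvPolynomialX_apply, map_sum, map_mul,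
      rename_X]
  have h2 : ∑ u : MatIdx n, X u * X (toLex ((ofLex u).2, (ofLex u).1) : MatIdx n) =
      ∑ p : Fin n × Fin n, (X (toLex p) * X (toLex (p.2, p.1)) : MvPolynomial (MatIdx n) k) :=
    (Fintype.sum_equiv toLex _ _ (fun p => rfl)).symm
  rw [h1, h2, Fintype.sum_prod_type]

/-! ## 2. The pair substitution -/

section Pair

variable {k : Type*} [Field k] {n : ℕ}

/-- The image of a letter under the pair substitution: `X_u ↦ s_u X_u + [τu ≠ u] X_{τu}` with
`s_u = -1` if `τu < u` and `1` otherwise. [folklore] -/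
theorem linSubst_pairMatrix_X (u : MatIdx n) :
    linSubst (MatIdx n) k
        (Matrix.of fun v w : MatIdx n =>
          (if v = w then (if (toLex ((ofLex w).2, (ofLex w).1) : MatIdx n) < w then (-1 : k) else 1)
            else 0) +
          (if v = toLex ((ofLex w).2, (ofLex w).1) then
            (if (toLex ((ofLex w).2, (ofLex w).1) : MatIdx n) ≠ w then (1 : k) else 0) else 0))
        (X u) =
      (if (toLex ((ofLex u).2, (ofLex u).1) : MatIdx n) < u then (-1 : k) else 1) • X u +
        (if (toLex ((ofLex u).2, (ofLex u).1) : MatIdx n) ≠ u then (1 : k) else 0) •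
          X (toLex ((ofLex u).2, (ofLex u).1) : MatIdx n) := by
  classical
  rw [linSubst_X]
  simp only [Matrix.of_apply, add_smul, Finset.sum_add_distrib, ite_smul, zero_smul,
    Finset.sum_ite_eq', Finset.mem_univ, if_true]

/-- The pair substitution on the products `X_u X_{τu}`:
`X_u X_{τu} ↦ X_u²` (`τu = u`), `X_u² - X_{τu}²` (`u < τu`), `X_{τu}² - X_u²` (`τu < u`). [folklore] -/
theorem linSubst_pairMatrix_X_mul_X (u : MatIdx n) :
    linSubst (MatIdx n) k
        (Matrix.of fun v w : MatIdx n =>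
          (if v = w then (if (toLex ((ofLex w).2, (ofLex w).1) : MatIdx n) < w then (-1 : k) else 1)
            else 0) +
          (if v = toLex ((ofLex w).2, (ofLex w).1) then
            (if (toLex ((ofLex w).2, (ofLex w).1) : MatIdx n) ≠ w then (1 : k) else 0) else 0))
        (X u * X (toLex ((ofLex u).2, (ofLex u).1) : MatIdx n)) =
      (if (toLex ((ofLex u).2, (ofLex u).1) : MatIdx n) = u then (1 : k)
        else if u < toLex ((ofLex u).2, (ofLex u).1) then 1 else -1) • X u ^ 2 +
      (if (toLex ((ofLex u).2, (ofLex u).1) : MatIdx n) = u then (0 : k)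
        else if u < toLex ((ofLex u).2, (ofLex u).1) then -1 else 1) •
          X (toLex ((ofLex u).2, (ofLex u).1) : MatIdx n) ^ 2 := by
  classical
  rw [map_mul, linSubst_pairMatrix_X, linSubst_pairMatrix_X, transposeLetter_invol]
  set v : MatIdx n := toLex ((ofLex u).2, (ofLex u).1) with hv
  by_cases huv : v = u
  · rw [huv]
    simp
    ring
  · have hvu' : u ≠ v := fun h => huv h.symm
    rcases lt_or_gt_of_ne huv with hlt | hgt
    · -- `τu < u`
      have h1 : ¬u < v := not_lt.mpr hlt.le
      simp [huv, hvu', hlt, h1]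
      ring
    · -- `u < τu`
      have h1 : ¬v < u := not_lt.mpr hgt.le
      simp [huv, hvu', hgt, h1]
      ring

/-- Summing the images: `∑_u (pair image of X_u X_{τu}) = ∑_u c_u X_u²` with `c_u = 1, 2, -2`
according as `τu = u`, `u < τu`, `τu < u` (reindex the `X_{τu}²` terms by the involution `τ`).
[folklore] -/
theorem sum_pair_images_eq (k : Type*) [Field k] (n : ℕ) :
    ∑ u : MatIdx n,
      ((if (toLex ((ofLex u).2, (ofLex u).1) : MatIdx n) = u then (1 : k)
          else if u < toLex ((ofLex u).2, (ofLex u).1) then 1 else -1) • (X u : MvPolynomial (MatIdx n) k) ^ 2 +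
        (if (toLex ((ofLex u).2, (ofLex u).1) : MatIdx n) = u then (0 : k)
          else if u < toLex ((ofLex u).2, (ofLex u).1) then -1 else 1) •
            (X (toLex ((ofLex u).2, (ofLex u).1) : MatIdx n) : MvPolynomial (MatIdx n) k) ^ 2) =
      ∑ u : MatIdx n,
        (if (toLex ((ofLex u).2, (ofLex u).1) : MatIdx n) = u then (1 : k)
          else if u < toLex ((ofLex u).2, (ofLex u).1) then 2 else -2) • (X u : MvPolynomial (MatIdx n) k) ^ 2 := by
  classical
  -- the involution `τ` as an equivalence
  let τ : MatIdx n ≃ MatIdx n :=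
    { toFun := fun u => toLex ((ofLex u).2, (ofLex u).1)
      invFun := fun u => toLex ((ofLex u).2, (ofLex u).1)
      left_inv := fun u => by simp
      right_inv := fun u => by simp }
  have hτ : ∀ u : MatIdx n, τ u = toLex ((ofLex u).2, (ofLex u).1) := fun u => rfl
  rw [Finset.sum_add_distrib]
  -- reindex the second sum by `τ`
  have hre : ∑ u : MatIdx n,
      (if (toLex ((ofLex u).2, (ofLex u).1) : MatIdx n) = u then (0 : k)
          else if u < toLex ((ofLex u).2, (ofLex u).1) then -1 else 1) •
        (X (toLex ((ofLex u).2, (ofLex u).1) : MatIdx n) : MvPolynomial (MatIdx n) k) ^ 2 =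
      ∑ u : MatIdx n,
        (if (toLex ((ofLex u).2, (ofLex u).1) : MatIdx n) = u then (0 : k)
          else if toLex ((ofLex u).2, (ofLex u).1) < u then -1 else 1) •
          (X u : MvPolynomial (MatIdx n) k) ^ 2 := by
    rw [← Equiv.sum_comp τ]
    refine Finset.sum_congr rfl fun u _ => ?_
    simp only [hτ, transposeLetter_invol]
    congr 1
    by_cases h : (toLex ((ofLex u).2, (ofLex u).1) : MatIdx n) = u
    · rw [if_pos h, if_pos]
      rw [h]
    · rw [if_neg h, if_neg (fun h' => h h'.symm)]
  rw [hre, ← Finset.sum_add_distrib]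
  refine Finset.sum_congr rfl fun u _ => ?_
  rw [← add_smul]
  congr 1
  by_cases h : (toLex ((ofLex u).2, (ofLex u).1) : MatIdx n) = u
  · simp [h]
  · rcases lt_or_gt_of_ne h with hlt | hgt
    · simp [h, hlt, not_lt.mpr hlt.le]; norm_num
    · have hgt' : u < toLex ((ofLex u).2, (ofLex u).1) := hgt
      simp [h, hgt', not_lt.mpr hgt'.le]; norm_num

/-- The square of the pair matrix is the diagonal matrix `diag(1 on diagonal letters, 2 else)`.
[folklore] -/
theorem pairMatrix_mul_self (k : Type*) [Field k] (n : ℕ) :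
    (Matrix.of fun v w : MatIdx n =>
          (if v = w then (if (toLex ((ofLex w).2, (ofLex w).1) : MatIdx n) < w then (-1 : k) else 1)
            else 0) +
          (if v = toLex ((ofLex w).2, (ofLex w).1) then
            (if (toLex ((ofLex w).2, (ofLex w).1) : MatIdx n) ≠ w then (1 : k) else 0) else 0)) *
      (Matrix.of fun v w : MatIdx n =>
          (if v = w then (if (toLex ((ofLex w).2, (ofLex w).1) : MatIdx n) < w then (-1 : k) else 1)
            else 0) +
          (if v = toLex ((ofLex w).2, (ofLex w).1) then
            (if (toLex ((ofLex w).2, (ofLex w).1) : MatIdx n) ≠ w then (1 : k) else 0) else 0)) =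
      Matrix.diagonal fun u =>
        if (toLex ((ofLex u).2, (ofLex u).1) : MatIdx n) = u then (1 : k) else 2 := by
  classical
  ext v u
  rw [Matrix.mul_apply, Matrix.diagonal_apply]
  -- only `w = u` and `w = τu` contribute
  simp only [Matrix.of_apply, mul_add, mul_ite, mul_zero, Finset.sum_add_distrib,
    Finset.sum_ite_eq', Finset.mem_univ, if_true, ofLex_toLex, toLex_ofLex, Prod.mk.eta]
  by_cases hvu : v = u
  · subst hvu
    rw [if_pos rfl]
    generalize (toLex ((ofLex v).2, (ofLex v).1) : MatIdx n) = t
    by_cases htv : t = v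
    · subst htv
      simp
    · have hvt : v ≠ t := fun h => htv h.symm
      rcases lt_or_gt_of_ne htv with hlt | hgt
      · have h1 : ¬v < t := not_lt.mpr hlt.le
        simp [*]
        norm_num
      · have hgt' : v < t := hgt
        have h1 : ¬t < v := not_lt.mpr hgt'.le
        simp [*]
        norm_num
  · rw [if_neg hvu]
    generalize (toLex ((ofLex u).2, (ofLex u).1) : MatIdx n) = t at *
    by_cases htu : t = u
    · subst htu
      simp [hvu]
    · have hut : u ≠ t := fun h => htu h.symm
      by_cases hvt : v = t
      · subst hvt
        rcases lt_or_gt_of_ne htu with hlt | hgt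
        · have h1 : ¬u < v := not_lt.mpr hlt.le
          simp [*]
        · have hgt' : u < v := hgt
          have h1 : ¬v < u := not_lt.mpr hgt'.le
          simp [*]
      · simp [hvu, hvt]

/-- **`tr X_n²` is `GL_{n²}`-equivalent to a full-rank diagonal quadric** (characteristic zero):
there is `h₀ ∈ GL (MatIdx n) k` with `h₀ · tr X_n² = ∑_u c_u X_u²`, `c_u = 1` on diagonal letters,
`2` if `u < τu`, `-2` if `τu < u`. [folklore] -/
theorem exists_gl_powFormLex_two_eq_diagonal (k : Type*) [Field k] [CharZero k] (n : ℕ) :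
    ∃ h₀ : GL (MatIdx n) k,
      linSubstRep (MatIdx n) k h₀ (powFormLex k n 2) =
        ∑ u : MatIdx n,
          (if (toLex ((ofLex u).2, (ofLex u).1) : MatIdx n) = u then (1 : k)
            else if u < toLex ((ofLex u).2, (ofLex u).1) then 2 else -2) • (X u : MvPolynomial (MatIdx n) k) ^ 2 := by
  classical
  set A : Matrix (MatIdx n) (MatIdx n) k := Matrix.of fun v w : MatIdx n =>
      (if v = w then (if (toLex ((ofLex w).2, (ofLex w).1) : MatIdx n) < w then (-1 : k) else 1)
        else 0) +
      (if v = toLex ((ofLex w).2, (ofLex w).1) then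
        (if (toLex ((ofLex w).2, (ofLex w).1) : MatIdx n) ≠ w then (1 : k) else 0) else 0)
    with hA
  have hdet : A.det ≠ 0 := by
    intro h0
    have h := congrArg Matrix.det (pairMatrix_mul_self k n)
    rw [← hA, Matrix.det_mul, h0, mul_zero, Matrix.det_diagonal] at h
    exact (Finset.prod_ne_zero_iff.mpr fun u _ => by split_ifs <;> norm_num) h.symm
  refine ⟨Matrix.GeneralLinearGroup.mkOfDetNeZero A hdet, ?_⟩
  rw [linSubstRep_apply, Matrix.GeneralLinearGroup.val_mkOfDetNeZero, powFormLex_two_eq, map_sum]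
  rw [← sum_pair_images_eq]
  refine Finset.sum_congr rfl fun u _ => ?_
  rw [hA]
  exact linSubst_pairMatrix_X_mul_X u

end Pair

/-! ## 3. Sign changes are upper triangular stabilisers of diagonal quadrics -/

section Sign

variable {σ k : Type*} [Fintype σ] [LinearOrder σ] [Field k]

/-- **Diagonal sign matrices fix every diagonal quadric**: for each letter `u` the matrix
`diag(1,…,-1,…,1)` (`-1` at `u`) is upper triangular, invertible, fixes `∑ c_v X_v²`, and has the
stated diagonal. [folklore] -/
theorem exists_upperTriangular_sign_fix_diagonal (c : σ → k) (u : σ) :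
    ∃ b : GL σ k, IsUpperTriangular b ∧
      linSubstRep σ k b (∑ v, c v • (X v : MvPolynomial σ k) ^ 2) = ∑ v, c v • (X v : MvPolynomial σ k) ^ 2 ∧
      ∀ i, (b : Matrix σ σ k) i i = if i = u then -1 else 1 := by
  classical
  set D : Matrix σ σ k := Matrix.diagonal fun i => if i = u then (-1 : k) else 1 with hD
  have hdet : D.det ≠ 0 := by
    rw [hD, Matrix.det_diagonal]
    exact Finset.prod_ne_zero_iff.mpr fun i _ => by split_ifs <;> norm_num
  refine ⟨Matrix.GeneralLinearGroup.mkOfDetNeZero D hdet, ?_, ?_, ?_⟩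
  · change (Matrix.GeneralLinearGroup.mkOfDetNeZero D hdet : Matrix σ σ k).BlockTriangular id
    rw [Matrix.GeneralLinearGroup.val_mkOfDetNeZero, hD]
    exact Matrix.blockTriangular_diagonal _
  · rw [linSubstRep_apply, Matrix.GeneralLinearGroup.val_mkOfDetNeZero, map_sum]
    refine Finset.sum_congr rfl fun v _ => ?_
    rw [map_smul, map_pow, linSubst_X]
    have hcol : (∑ j, D j v • (X j : MvPolynomial σ k)) = (if v = u then (-1 : k) else 1) • X v := by
      rw [hD]
      simp only [Matrix.diagonal_apply, ite_smul, zero_smul, Finset.sum_ite_eq', Finset.mem_univ,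
        if_true]
    rw [hcol, smul_pow, ← neg_one_sq.symm.trans rfl |>.symm.trans rfl]
    congr 1
    split_ifs <;> simp
  · intro i
    rw [Matrix.GeneralLinearGroup.val_mkOfDetNeZero, hD, Matrix.diagonal_apply_eq]

/-- **Sign stabilisers transported along `h₀`**: if `h₀ · f` is a diagonal quadric then every
letter `u` carries an upper triangular `b` with `(b h₀) · f = h₀ · f` and diagonal `(1,…,-1,…,1)` —
hypothesis `hsign` of `rowTwo_bound_of_sign_of_fund` for this `h₀`. [folklore] -/
theorem hsign_of_linSubstRep_eq_diagonal (f : MvPolynomial σ k) (h₀ : GL σ k) (c : σ → k)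
    (h : linSubstRep σ k h₀ f = ∑ v, c v • (X v : MvPolynomial σ k) ^ 2) (u : σ) :
    ∃ b : GL σ k, IsUpperTriangular b ∧
      linSubstRep σ k (b * h₀) f = linSubstRep σ k h₀ f ∧
      ∀ i, (b : Matrix σ σ k) i i = if i = u then -1 else 1 := by
  obtain ⟨b, hb, hfix, hdiag⟩ := exists_upperTriangular_sign_fix_diagonal (k := k) c u
  refine ⟨b, hb, ?_, hdiag⟩
  rw [map_mul, Module.End.mul_apply, h, hfix]

/-- **`hsign` for `tr X_n²`**: with `h₀` from `exists_gl_powFormLex_two_eq_diagonal`, every letter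
carries an upper triangular sign change fixing `h₀ · tr X_n²` (hypothesis `hsign` of
`rowTwo_bound_of_sign_of_fund`; combine with `hsign_of_linSubstRep_eq_diagonal` to share the `h₀` of
a density statement). [folklore] -/
theorem hsign_powFormLex_two (k : Type*) [Field k] [CharZero k] (n : ℕ) :
    ∃ h₀ : GL (MatIdx n) k,
      linSubstRep (MatIdx n) k h₀ (powFormLex k n 2) =
        ∑ u : MatIdx n,
          (if (toLex ((ofLex u).2, (ofLex u).1) : MatIdx n) = u then (1 : k)
            else if u < toLex ((ofLex u).2, (ofLex u).1) then 2 else -2) • (X u : MvPolynomial (MatIdx n) k) ^ 2 ∧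
      ∀ u : MatIdx n, ∃ b : GL (MatIdx n) k, IsUpperTriangular b ∧
        linSubstRep (MatIdx n) k (b * h₀) (powFormLex k n 2) =
          linSubstRep (MatIdx n) k h₀ (powFormLex k n 2) ∧
        ∀ i, (b : Matrix (MatIdx n) (MatIdx n) k) i i = if i = u then -1 else 1 := by
  obtain ⟨h₀, hh₀⟩ := exists_gl_powFormLex_two_eq_diagonal k n
  exact ⟨h₀, hh₀, fun u => hsign_of_linSubstRep_eq_diagonal _ h₀ _ hh₀ u⟩

end Sign

end

end Summit.ValiantsHypothesis.ValiantsHypothesis.Theorems.GeneratorObstructions.PowGenDegreeQP
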